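import Summits.RiemannHypothesis.RiemannHypothesis.Theorems.Splittings.LiIndexSetsSyndetic
import Literature.NumberTheory.LFunctions.RiemannHypothesisUpTo1000X
import HarnessLib

/-!
# Splittings / Li — SLOW RECURRENCE: what Bombieri–Lagarias + a zero-free height consume, and the
# RH-equivalent Li criteria on every index set `S` with `S − c` Bohr recurrent, `|c| ≤ 200` (zero-def raw form)

Cell rh-split, seat rh-split-li-neg g3 (card `cards/SPLIT-li-neg.md` §9 «HEIGHT-RESCUE DICHOTOMY»; referee g2 01:27:02Z:
DELIVERABLE, labels (1)–(4) CONFIRMED; lead g2 02:39:16Z: only the zero-def-able census theorems tonight, the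
def-carrying remainder (named print recurrence facts §6, the multiset-criterion machinery §§7–8, 13 defs) to the
HANDOFF); scratch `HOME/rh-split-li-neg/LiSlowRecurrence.lean` sha16 e8ec9abfbb5d6735 §§1–5, zero-def raw form by
rh-split-typer-1 g3.  DICTIONARY (the seat's two Props SPELLED OUT): `IsSlowRecurrent S δ` («`S` is slow-recurrent at
scale `δ`»: every finite family of unit complex numbers each within `δ` of `1` returns simultaneously, `Re zᵢⁿ ≥ 1/2`,
at arbitrarily large `n ∈ S`) is `∀ k (z : Fin k → ℂ), (∀ i, ‖z i‖ = 1) → (∀ i, ‖z i − 1‖ ≤ δ) → ∀ N, ∃ n ∈ S, N ≤ n ∧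
∀ i, 1/2 ≤ Re (z i ^ n)`; `IsBohrRecurrentShift S c` («`S − c` is a set of Bohr recurrence») is `∀ k z, (∀ i, ‖z i‖ = 1) →
∀ ε > 0, ∀ N, ∃ n ∈ S, N ≤ n ∧ ∀ i, ‖z i ^ (n − c) − 1‖ < ε`.  (`IsLiRecurrent`, `LiPosOn`, `RecurrentFor`, `HasGapsLe`,
`weight` are the tree's, `Splittings/LiIndexSets*.lean`.)

Content (proofs verbatim; dot-notation lemma names flattened): §1 slow recurrence — monotone in `S` and `δ`, `= IsLiRecurrent`
at scale `2`, finset form, from bounded gaps (`isSlowRecurrent_of_hasGapsLe`, tree Part F); §2 SHIFTED BOHR RECURRENCE ⟹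
slow recurrence at every scale `δ` with `|c| δ ≤ 2/5` (`isSlowRecurrent_of_bohrShift`); §3 slow recurrence at scale `2/H`
is exactly what Bombieri–Lagarias' proof consumes for a family whose off-disc members have `|ρ − 1| ≥ H`
(`recurrentFor_of_isSlowRecurrent`); §4 reflected families (`recurrentFor_reflect_of_isSlowRecurrent`,
`exists_tsum_neg_pos_of_isSlowRecurrent`); §5 zeta level: `RH(H) ∧ [S slow-recurrent at scale 2/H] ⟹ (RH ⟺ λ_n ≥ 0
on S)` (`riemannHypothesis_iff_liPosOn_of_rhUpTo_of_isSlowRecurrent`), instances `H = 101`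
(`riemannHypothesisUpTo_hundredOne`) and `H = 1000` (`riemannHypothesisUpTo_1000`, kernel `decide`, standard axioms):
**every `S` with `S − c` Bohr recurrent, `|c| ≤ 200`, carries an RH-EQUIVALENT Li criterion `RH ⟺ LiPosOn S`**
(`riemannHypothesis_iff_liPosOn_of_bohrShift_le_200`).  The instances on primes / squares / `m²+1` need the PRINT
recurrence theorems [Sárközy 1978; Kamae–Mendès France 1978; Furstenberg 1981] as hypotheses and stay in the seat's
HOME file.  Labels (referee): RH-EQUIVALENT record statements; class li×neg UNCHANGED; nothing here bears on the truth
of RH.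

HONEST LABEL: «SPLITTING SEARCH over kernel-typed RH-EQUIVALENCES; a splitting A ∧ B ⟹ RH is CONDITIONAL
bookkeeping unless A and B are both proved; nothing here bears on the truth of RH.»
-/

set_option linter.dupNamespace false

noncomputable section

open Complex

namespace Summit.RiemannHypothesis.RiemannHypothesis.Theorems.Splittings.LiSlowRecurrence

open Literature.NumberTheory.LFunctions
open Literature.NumberTheory.LFunctions.BombieriLagarias
open Literature.NumberTheory.DiophantineGeometry (RiemannHypothesisUpTo)
open Summit.RiemannHypothesis.RiemannHypothesis.Theorems.Splittings
open Summit.RiemannHypothesis.RiemannHypothesis.Theorems.Splittings.LiIndexSets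
open scoped ComplexConjugate

/-! ## §1 Slow (small-phase) recurrence -/

/-- Supersets inherit slow recurrence. [folklore] -/
theorem isSlowRecurrent_mono {S T : Set ℕ} {δ : ℝ} (hS : (∀ (k : ℕ) (z : Fin k → ℂ), (∀ i, ‖z i‖ = 1) →
      (∀ i, ‖z i - 1‖ ≤ δ) →
      ∀ N : ℕ, ∃ n ∈ S, N ≤ n ∧ ∀ i, (1 : ℝ) / 2 ≤ (z i ^ n).re)) (hST : S ⊆ T) :
    (∀ (k : ℕ) (z : Fin k → ℂ), (∀ i, ‖z i‖ = 1) → (∀ i, ‖z i - 1‖ ≤ δ) →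
      ∀ N : ℕ, ∃ n ∈ T, N ≤ n ∧ ∀ i, (1 : ℝ) / 2 ≤ (z i ^ n).re) := by
  intro k z hz hδ N
  obtain ⟨n, hnS, hNn, hn⟩ := hS k z hz hδ N
  exact ⟨n, hST hnS, hNn, hn⟩

/-- Slow recurrence is antitone in the scale. [folklore] -/
theorem isSlowRecurrent_anti {S : Set ℕ} {δ δ' : ℝ} (hS : (∀ (k : ℕ) (z : Fin k → ℂ), (∀ i, ‖z i‖ =
      1) → (∀ i, ‖z i - 1‖ ≤ δ) →
      ∀ N : ℕ, ∃ n ∈ S, N ≤ n ∧ ∀ i, (1 : ℝ) / 2 ≤ (z i ^ n).re)) (h : δ' ≤ δ) :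
    (∀ (k : ℕ) (z : Fin k → ℂ), (∀ i, ‖z i‖ = 1) → (∀ i, ‖z i - 1‖ ≤ δ') →
      ∀ N : ℕ, ∃ n ∈ S, N ≤ n ∧ ∀ i, (1 : ℝ) / 2 ≤ (z i ^ n).re) :=
  fun k z hz hδ N ↦ hS k z hz (fun i ↦ (hδ i).trans h) N

/-- Full recurrence is slow recurrence at every scale. [folklore] -/
theorem isSlowRecurrent_of_isLiRecurrent {S : Set ℕ} (hS : IsLiRecurrent S) (δ : ℝ) :
    (∀ (k : ℕ) (z : Fin k → ℂ), (∀ i, ‖z i‖ = 1) → (∀ i, ‖z i - 1‖ ≤ δ) →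
      ∀ N : ℕ, ∃ n ∈ S, N ≤ n ∧ ∀ i, (1 : ℝ) / 2 ≤ (z i ^ n).re) :=
  fun k z hz _ N ↦ hS k z hz N

/-- Conversely slow recurrence at scale `2` is full recurrence (every unit `z` has `‖z − 1‖ ≤ 2`). [folklore] -/
theorem isLiRecurrent_of_isSlowRecurrent_two {S : Set ℕ} (hS : (∀ (k : ℕ) (z : Fin k →
      ℂ), (∀ i, ‖z i‖ = 1) → (∀ i, ‖z i - 1‖ ≤ 2) →
      ∀ N : ℕ, ∃ n ∈ S, N ≤ n ∧ ∀ i, (1 : ℝ) / 2 ≤ (z i ^ n).re)) :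
    IsLiRecurrent S := by
  intro k z hz N
  refine hS k z hz (fun i ↦ ?_) N
  calc ‖z i - 1‖ ≤ ‖z i‖ + ‖(1 : ℂ)‖ := norm_sub_le _ _
    _ = 2 := by rw [hz i, norm_one]; norm_num

/-- Finset-indexed form. [folklore] -/
theorem isSlowRecurrent_finset {S : Set ℕ} {δ : ℝ} (hS : (∀ (k : ℕ) (z : Fin k → ℂ), (∀ i, ‖z i‖ = 1) →
      (∀ i, ‖z i - 1‖ ≤ δ) →
      ∀ N : ℕ, ∃ n ∈ S, N ≤ n ∧ ∀ i, (1 : ℝ) / 2 ≤ (z i ^ n).re)) {ι : Type*}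
    (B : Finset ι) (z : ι → ℂ) (hz : ∀ i ∈ B, ‖z i‖ = 1) (hδ : ∀ i ∈ B, ‖z i - 1‖ ≤ δ) (N : ℕ) :
    ∃ n ∈ S, N ≤ n ∧ ∀ i ∈ B, 1 / 2 ≤ (z i ^ n).re := by
  classical
  obtain ⟨n, hnS, hNn, hn⟩ := hS B.card (fun j ↦ z (B.equivFin.symm j))
    (fun j ↦ hz _ (B.equivFin.symm j).2) (fun j ↦ hδ _ (B.equivFin.symm j).2) N
  refine ⟨n, hnS, hNn, fun i hi ↦ ?_⟩
  have := hn (B.equivFin ⟨i, hi⟩)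
  simpa using this

/-- **Bounded gaps give slow recurrence** (tree `exists_mem_forall_half_le_re_pow_of_gaps`, Part F):
gaps `≤ g` and `g δ ≤ 2/5`. [folklore] -/
theorem isSlowRecurrent_of_hasGapsLe {S : Set ℕ} {g : ℕ} (hS : HasGapsLe S g) {δ : ℝ}
    (hg : (g : ℝ) * δ ≤ 2 / 5) : (∀ (k : ℕ) (z : Fin k → ℂ), (∀ i, ‖z i‖ = 1) → (∀ i, ‖z i - 1‖ ≤ δ) →
      ∀ N : ℕ, ∃ n ∈ S, N ≤ n ∧ ∀ i, (1 : ℝ) / 2 ≤ (z i ^ n).re) := by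
  intro k z hz hδ N
  obtain ⟨n, hnS, hNn, hn⟩ := exists_mem_forall_half_le_re_pow_of_gaps (Finset.univ : Finset (Fin k))
    z (fun i _ ↦ hz i) (fun i _ ↦ hδ i) hS hg N
  exact ⟨n, hnS, hNn, fun i ↦ hn i (Finset.mem_univ i)⟩

/-! ## §2 Shifted Bohr recurrence ⇒ slow recurrence -/

/-- `|u⁻¹ − 1| = |u − 1|` for a unit complex number. [folklore] -/
private theorem norm_inv_sub_one_of_norm_eq_one {u : ℂ} (hu : ‖u‖ = 1) : ‖u⁻¹ - 1‖ = ‖u - 1‖ := by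
  have hu0 : u ≠ 0 := by
    intro h; rw [h, norm_zero] at hu; exact zero_ne_one hu
  have e : u⁻¹ - 1 = -(u - 1) / u := by field_simp; ring
  rw [e, norm_div, norm_neg, hu, div_one]

/-- `|z^c − 1| ≤ |c| · |z − 1|` for a unit complex number and an integer exponent. [folklore] -/
theorem norm_zpow_sub_one_le {z : ℂ} (hz : ‖z‖ = 1) (c : ℤ) :
    ‖z ^ c - 1‖ ≤ |(c : ℝ)| * ‖z - 1‖ := by
  obtain ⟨m, rfl | rfl⟩ := Int.eq_nat_or_neg c
  · rw [zpow_natCast]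
    simpa using norm_pow_sub_one_le hz m
  · rw [zpow_neg, zpow_natCast, norm_inv_sub_one_of_norm_eq_one (by rw [norm_pow, hz, one_pow])]
    simpa using norm_pow_sub_one_le hz m

/-- **Shifted Bohr recurrence gives slow recurrence** at every scale `δ ≥ 0` with `|c| δ ≤ 2/5`:
`|zⁿ − 1| ≤ |z^{n−c} − 1| + |z^c − 1| ≤ 1/10 + |c| δ ≤ 1/2`. [folklore] -/
theorem isSlowRecurrent_of_bohrShift {S : Set ℕ} {c : ℤ} (hS : (∀ (k : ℕ) (z : Fin k →
      ℂ), (∀ i, ‖z i‖ = 1) → ∀ ε : ℝ, 0 < ε →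
      ∀ N : ℕ, ∃ n ∈ S, N ≤ n ∧ ∀ i, ‖z i ^ ((n : ℤ) - c) - 1‖ < ε))
    {δ : ℝ} (hc : |(c : ℝ)| * δ ≤ 2 / 5) : (∀ (k : ℕ) (z : Fin k → ℂ), (∀ i, ‖z i‖ = 1) → (∀ i, ‖z i - 1‖ ≤ δ) →
      ∀ N : ℕ, ∃ n ∈ S, N ≤ n ∧ ∀ i, (1 : ℝ) / 2 ≤ (z i ^ n).re) := by
  intro k z hz hδ N
  obtain ⟨n, hnS, hNn, hn⟩ := hS k z hz (1 / 10) (by norm_num) N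
  refine ⟨n, hnS, hNn, fun i ↦ ?_⟩
  have hz0 : z i ≠ 0 := by
    intro h; have := hz i; rw [h, norm_zero] at this; exact zero_ne_one this
  have hsplit : z i ^ n - 1 = z i ^ c * (z i ^ ((n : ℤ) - c) - 1) + (z i ^ c - 1) := by
    have : z i ^ (n : ℤ) = z i ^ c * z i ^ ((n : ℤ) - c) := by
      rw [← zpow_add₀ hz0]; congr 1; ring
    rw [← zpow_natCast, this]; ring
  have hzc : ‖z i ^ c‖ = 1 := by rw [norm_zpow, hz i, one_zpow]
  have h1 : ‖z i ^ n - 1‖ ≤ 1 / 2 := by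
    rw [hsplit]
    calc ‖z i ^ c * (z i ^ ((n : ℤ) - c) - 1) + (z i ^ c - 1)‖
        ≤ ‖z i ^ c * (z i ^ ((n : ℤ) - c) - 1)‖ + ‖z i ^ c - 1‖ := norm_add_le _ _
      _ = ‖z i ^ ((n : ℤ) - c) - 1‖ + ‖z i ^ c - 1‖ := by rw [norm_mul, hzc, one_mul]
      _ ≤ 1 / 10 + |(c : ℝ)| * ‖z i - 1‖ := add_le_add (hn i).le (norm_zpow_sub_one_le (hz i) c)
      _ ≤ 1 / 10 + |(c : ℝ)| * δ := by gcongr; exact hδ i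
      _ ≤ 1 / 2 := by linarith
  have hre : 1 - (z i ^ n).re ≤ ‖z i ^ n - 1‖ := by
    have h := Complex.re_le_norm (1 - z i ^ n)
    rw [norm_sub_rev] at h
    simpa only [sub_re, one_re] using h
  linarith

/-- Bohr recurrence of `S` itself (`c = 0`) is full Li-recurrence. [folklore] -/
theorem isLiRecurrent_of_bohrShift {S : Set ℕ} (hS : (∀ (k : ℕ) (z : Fin k → ℂ), (∀ i, ‖z i‖ = 1) →
      ∀ ε : ℝ, 0 < ε →
      ∀ N : ℕ, ∃ n ∈ S, N ≤ n ∧ ∀ i, ‖z i ^ ((n : ℤ) - 0) - 1‖ < ε)) :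
    IsLiRecurrent S :=
  isLiRecurrent_of_isSlowRecurrent_two (isSlowRecurrent_of_bohrShift hS (by norm_num))

/-- Supersets inherit shifted Bohr recurrence. [folklore] -/
theorem bohrShift_mono {S T : Set ℕ} {c : ℤ} (hS : (∀ (k : ℕ) (z : Fin k → ℂ), (∀ i, ‖z i‖ = 1) →
      ∀ ε : ℝ, 0 < ε →
      ∀ N : ℕ, ∃ n ∈ S, N ≤ n ∧ ∀ i, ‖z i ^ ((n : ℤ) - c) - 1‖ < ε)) (hST : S ⊆ T) :
    (∀ (k : ℕ) (z : Fin k → ℂ), (∀ i, ‖z i‖ = 1) → ∀ ε : ℝ, 0 < ε →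
      ∀ N : ℕ, ∃ n ∈ T, N ≤ n ∧ ∀ i, ‖z i ^ ((n : ℤ) - c) - 1‖ < ε) := by
  intro k z hz ε hε N
  obtain ⟨n, hn, hNn, h'⟩ := hS k z hz ε hε N
  exact ⟨n, hST hn, hNn, h'⟩

/-- Translating the set translates the shift: if `S − c` is Bohr recurrent then so is `(S + d) − (c + d)`.
[folklore] -/
theorem bohrShift_image_add {S : Set ℕ} {c : ℤ} (hS : (∀ (k : ℕ) (z : Fin k → ℂ), (∀ i, ‖z i‖ = 1) →
      ∀ ε : ℝ, 0 < ε →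
      ∀ N : ℕ, ∃ n ∈ S, N ≤ n ∧ ∀ i, ‖z i ^ ((n : ℤ) - c) - 1‖ < ε)) (d : ℕ) :
    (∀ (k : ℕ) (z : Fin k → ℂ), (∀ i, ‖z i‖ = 1) → ∀ ε : ℝ, 0 < ε →
      ∀ N : ℕ, ∃ n ∈ ((· + d) '' S), N ≤ n ∧ ∀ i, ‖z i ^ ((n : ℤ) - (c + d)) - 1‖ < ε) := by
  intro k z hz ε hε N
  obtain ⟨n, hnS, hNn, hn⟩ := hS k z hz ε hε N
  refine ⟨n + d, ⟨n, hnS, rfl⟩, by omega, fun i ↦ ?_⟩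
  have : ((n + d : ℕ) : ℤ) - (c + d) = (n : ℤ) - c := by push_cast; ring
  rw [this]; exact hn i

/-! ## §3 Slow recurrence is what Bombieri–Lagarias' proof consumes, given a zero-free height -/

section BL

variable {ι : Type*} {ρ : ι → ℂ} {m : ι → ℕ}

/-- **Recurrence for a family from slow recurrence.**  If every member of the family outside the closed
unit disc has `|ρ_i − 1| ≥ H > 0`, then every `S` slow-recurrent at scale `2/H` is recurrent for the
family (tree `recurrentFor_of_gaps` with the gap hypothesis replaced by the abstract one: for such
members `w_i = 1 + (ρ_i − 1)⁻¹` is within `1/H` of `1`, so `w_i/|w_i|` is within `2/H`).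
[cite: BombieriLagarias1999, Thm. 1] -/
theorem recurrentFor_of_isSlowRecurrent (h0 : ∀ i, ρ i ≠ 0) (h1 : ∀ i, ρ i ≠ 1) {H : ℝ} (hHpos : 0 < H)
    (hH : ∀ i, 1 < ‖(1 - 1 / ρ i)⁻¹‖ → H ≤ ‖ρ i - 1‖) {S : Set ℕ}
    (hS : (∀ (k : ℕ) (z : Fin k → ℂ), (∀ i, ‖z i‖ = 1) → (∀ i, ‖z i - 1‖ ≤ (2 / H)) →
      ∀ N : ℕ, ∃ n ∈ S, N ≤ n ∧ ∀ i, (1 : ℝ) / 2 ≤ (z i ^ n).re)) : RecurrentFor ρ S := by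
  intro B hB N
  set w : ι → ℂ := fun i ↦ (1 - 1 / ρ i)⁻¹ with hw
  have key : ∀ i ∈ B, ‖w i / ((‖w i‖ : ℝ) : ℂ) - 1‖ ≤ 2 / H := by
    intro i hi
    have hwi : 1 < ‖w i‖ := hB i hi
    have hw0 : 0 < ‖w i‖ := by linarith
    have hρ1 : 0 < ‖ρ i - 1‖ := lt_of_lt_of_le hHpos (hH i hwi)
    have hwsub : ‖w i - 1‖ ≤ H⁻¹ := by
      have e : w i - 1 = (ρ i - 1)⁻¹ := by
        show (1 - 1 / ρ i)⁻¹ - 1 = (ρ i - 1)⁻¹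
        rw [inv_one_sub_inv_eq_one_add (h0 i) (h1 i)]; ring
      rw [e, norm_inv]
      exact (inv_le_inv₀ hρ1 hHpos).2 (hH i hwi)
    have habs : |1 - ‖w i‖| ≤ ‖w i - 1‖ := by
      have h := abs_norm_sub_norm_le (1 : ℂ) (w i)
      rwa [norm_one, norm_sub_rev] at h
    have hne : ((‖w i‖ : ℝ) : ℂ) ≠ 0 := Complex.ofReal_ne_zero.2 hw0.ne'
    have hz1 : w i / ((‖w i‖ : ℝ) : ℂ) - 1 = (w i - ((‖w i‖ : ℝ) : ℂ)) / ((‖w i‖ : ℝ) : ℂ) :=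
      div_sub_one hne
    have hn1 : ‖(1 : ℂ) - ((‖w i‖ : ℝ) : ℂ)‖ = |1 - ‖w i‖| := by
      rw [← Complex.ofReal_one, ← Complex.ofReal_sub, Complex.norm_real, Real.norm_eq_abs]
    rw [hz1, norm_div, Complex.norm_real, Real.norm_of_nonneg hw0.le]
    calc ‖w i - ((‖w i‖ : ℝ) : ℂ)‖ / ‖w i‖ ≤ ‖w i - ((‖w i‖ : ℝ) : ℂ)‖ :=
          div_le_self (norm_nonneg _) hwi.le
      _ = ‖(w i - 1) + ((1 : ℂ) - ((‖w i‖ : ℝ) : ℂ))‖ := by congr 1; ring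
      _ ≤ ‖w i - 1‖ + ‖(1 : ℂ) - ((‖w i‖ : ℝ) : ℂ)‖ := norm_add_le _ _
      _ = ‖w i - 1‖ + |1 - ‖w i‖| := by rw [hn1]
      _ ≤ H⁻¹ + H⁻¹ := add_le_add hwsub (habs.trans hwsub)
      _ = 2 / H := by rw [div_eq_mul_inv]; ring
  exact isSlowRecurrent_finset hS B (fun i ↦ w i / ((‖w i‖ : ℝ) : ℂ))
    (fun i hi ↦ by
      have hw0 : (0 : ℝ) < ‖w i‖ := by linarith [hB i hi]
      rw [norm_div, Complex.norm_real, Real.norm_of_nonneg hw0.le, div_self hw0.ne'])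
    key N

end BL

/-! ## §4 Reflected families: slow recurrence at scale `2/H` is recurrence for `1 − ρ̄` whenever the
members of height `≤ H` are on the line -/

section Reflect

variable {ι : Type*} {ρ : ι → ℂ} {m : ι → ℕ}

/-- **Slow recurrence at scale `2/H` is recurrence for the reflected family `1 − ρ̄`** of any family
(`ρ_i ≠ 0, 1`) whose members of height `|Im ρ_i| ≤ H` lie on `Re = 1/2`: a member of the reflected family
outside the closed unit disc is `1 − ρ̄_i` with `Re ρ_i < 1/2`, hence `|Im ρ_i| > H`, hence
`|(1 − ρ̄_i) − 1| = |ρ_i| > H`. [cite: BombieriLagarias1999, Thm. 1] -/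
theorem recurrentFor_reflect_of_isSlowRecurrent (h0 : ∀ i, ρ i ≠ 0) (h1 : ∀ i, ρ i ≠ 1) {H : ℝ}
    (hHpos : 0 < H) (hline : ∀ i, |(ρ i).im| ≤ H → (ρ i).re = 1 / 2) {S : Set ℕ}
    (hS : (∀ (k : ℕ) (z : Fin k → ℂ), (∀ i, ‖z i‖ = 1) → (∀ i, ‖z i - 1‖ ≤ (2 / H)) →
      ∀ N : ℕ, ∃ n ∈ S, N ≤ n ∧ ∀ i, (1 : ℝ) / 2 ≤
          (z i ^ n).re)) : RecurrentFor (fun i ↦ 1 - conj (ρ i)) S := by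
  have h0' : ∀ i, 1 - conj (ρ i) ≠ 0 := by
    intro i h
    apply h1 i
    have : conj (ρ i) = 1 := by linear_combination -h
    simpa using congrArg conj this
  have h1' : ∀ i, 1 - conj (ρ i) ≠ 1 := by
    intro i h
    apply h0 i
    have : conj (ρ i) = 0 := by linear_combination -h
    simpa using this
  refine recurrentFor_of_isSlowRecurrent h0' h1' hHpos (fun i hw ↦ ?_) hS
  have hre : (ρ i).re < 1 / 2 := by
    have := (one_lt_norm_inv_one_sub_inv_iff (h1' i)).1 hw
    simp only [sub_re, one_re, Complex.conj_re] at this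
    linarith
  have hgt : H < |(ρ i).im| := by
    by_contra hle
    exact absurd (hline i (not_lt.1 hle)) hre.ne
  calc H ≤ |(ρ i).im| := hgt.le
    _ ≤ ‖ρ i‖ := Complex.abs_im_le_norm _
    _ = ‖(1 - conj (ρ i)) - 1‖ := by rw [sub_sub_cancel_left, norm_neg, Complex.norm_conj]

/-- **The `+n` Li form along a slow-recurrent set, contrapositive**: a member with `Re ρ_{i₀} < 1/2` in a
family on the line up to height `H` forces a negative Li sum at some index `n ∈ S`, `S` slow-recurrent at
scale `2/H` (tree `exists_tsum_neg_pos_of_recurrentFor` = Bombieri–Lagarias' proof verbatim).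
[cite: BombieriLagarias1999, Thm. 1] -/
theorem exists_tsum_neg_pos_of_isSlowRecurrent (hm : ∀ i, 0 < m i) (h0 : ∀ i, ρ i ≠ 0)
    (h1 : ∀ i, ρ i ≠ 1) (hR : Summable (weight (fun i ↦ 1 - conj (ρ i)) m)) {H : ℝ} (hHpos : 0 < H)
    (hline : ∀ i, |(ρ i).im| ≤ H → (ρ i).re = 1 / 2) {i₀ : ι} (hi₀ : (ρ i₀).re < 1 / 2) {S : Set ℕ}
    (hS : (∀ (k : ℕ) (z : Fin k → ℂ), (∀ i, ‖z i‖ = 1) → (∀ i, ‖z i - 1‖ ≤ (2 / H)) →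
      ∀ N : ℕ, ∃ n ∈ S, N ≤ n ∧ ∀ i, (1 : ℝ) / 2 ≤ (z i ^ n).re)) :
    ∃ n ∈ S, 1 ≤ n ∧ ∑' i, (m i : ℝ) * (1 - (1 - 1 / ρ i) ^ n).re < 0 :=
  exists_tsum_neg_pos_of_recurrentFor hm h0 h1 hR hi₀
    (recurrentFor_reflect_of_isSlowRecurrent h0 h1 hHpos hline hS)

end Reflect

/-! ## §5 Zeta level: `RH(H) ∧ [S slow-recurrent at scale 2/H] ⟹ (RH ⟺ λ_n ≥ 0 on S)` -/

/-- A non-trivial zero of `ζ` is not `0`. [folklore] -/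
private theorem zetaZero_ne_zero (ρ : ZetaZeros.riemannZetaNontrivialZeros) : (ρ : ℂ) ≠ 0 := by
  intro h
  have := ZetaZeros.riemannZetaNontrivialZeros.re_pos ρ.2
  rw [h] at this
  simp at this

/-- **The zeros of ζ make every set slow-recurrent at scale `2/H` recurrent, given the zeros to height `H`.**
[cite: BombieriLagarias1999, Thm. 1] -/
theorem recurrentFor_zetaZeros_of_isSlowRecurrent {H : ℝ} (hHpos : 0 < H)
    (hlow : ∀ ρ ∈ ZetaZeros.riemannZetaNontrivialZeros, |ρ.im| ≤ H → ρ.re = 1 / 2)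
    {S : Set ℕ} (hS : (∀ (k : ℕ) (z : Fin k → ℂ), (∀ i, ‖z i‖ = 1) → (∀ i, ‖z i - 1‖ ≤ (2 / H)) →
      ∀ N : ℕ, ∃ n ∈ S, N ≤ n ∧ ∀ i, (1 : ℝ) / 2 ≤ (z i ^ n).re)) :
    RecurrentFor (fun ρ : ZetaZeros.riemannZetaNontrivialZeros ↦ 1 - conj (ρ : ℂ)) S :=
  recurrentFor_reflect_of_isSlowRecurrent (fun ρ ↦ zetaZero_ne_zero ρ)
    (fun ρ ↦ ZetaZeros.riemannZetaNontrivialZeros.ne_one ρ.2) hHpos (fun ρ h ↦ hlow ρ ρ.2 h) hS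

/-- **Li positivity on a slow-recurrent set implies RH, given the zeros up to height `H`.**
[cite: BombieriLagarias1999, Thm. 1] -/
theorem riemannHypothesis_of_liPosOn_of_isSlowRecurrent {H : ℝ} (hHpos : 0 < H)
    (hlow : ∀ ρ ∈ ZetaZeros.riemannZetaNontrivialZeros, |ρ.im| ≤ H → ρ.re = 1 / 2)
    {S : Set ℕ} (hS : (∀ (k : ℕ) (z : Fin k → ℂ), (∀ i, ‖z i‖ = 1) → (∀ i, ‖z i - 1‖ ≤ (2 / H)) →
      ∀ N : ℕ, ∃ n ∈ S, N ≤ n ∧ ∀ i, (1 : ℝ) / 2 ≤ (z i ^ n).re)) (h : LiPosOn S) : _root_.RiemannHypothesis :=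
  riemannHypothesis_of_liPosOn_of_recurrentFor (recurrentFor_zetaZeros_of_isSlowRecurrent hHpos hlow hS) h

/-- `RiemannHypothesisUpTo H ∧ [λ_n ≥ 0 on a set slow-recurrent at scale 2/H] → RH`, and conversely.
[cite: BombieriLagarias1999, Thm. 1] -/
theorem riemannHypothesis_iff_liPosOn_of_rhUpTo_of_isSlowRecurrent {H : ℝ} (hA : RiemannHypothesisUpTo H)
    (hHpos : 0 < H) {S : Set ℕ} (hS : (∀ (k : ℕ) (z : Fin k → ℂ), (∀ i, ‖z i‖ = 1) → (∀ i, ‖z i - 1‖ ≤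
        (2 / H)) →
      ∀ N : ℕ, ∃ n ∈ S, N ≤ n ∧ ∀ i, (1 : ℝ) / 2 ≤ (z i ^ n).re)) :
    _root_.RiemannHypothesis ↔ LiPosOn S :=
  ⟨fun h n _ hn ↦ (li_criterion_holds.1 h) n hn,
    riemannHypothesis_of_liPosOn_of_isSlowRecurrent hHpos
      (fun _ hρ hle ↦ re_eq_half_of_abs_im_le hA hρ hle) hS⟩

/-- With the tree's unconditional `riemannHypothesisUpTo_hundredOne` (standard axioms): **every set
slow-recurrent at scale `2/101` carries an RH-equivalent Li criterion.** [cite: BombieriLagarias1999, Thm. 1] -/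
theorem riemannHypothesis_iff_liPosOn_of_isSlowRecurrent_101 {S : Set ℕ}
    (hS : (∀ (k : ℕ) (z : Fin k → ℂ), (∀ i, ‖z i‖ = 1) → (∀ i, ‖z i - 1‖ ≤ (2 / 101)) →
      ∀ N : ℕ, ∃ n ∈ S, N ≤ n ∧ ∀ i, (1 : ℝ) / 2 ≤ (z i ^ n).re)) : _root_.RiemannHypothesis ↔ LiPosOn S :=
  riemannHypothesis_iff_liPosOn_of_rhUpTo_of_isSlowRecurrent riemannHypothesisUpTo_hundredOne
    (by norm_num) hS

/-- **Shifted Bohr recurrence + verified height `H ≥ 5|c|`** ⟹ RH-equivalent Li criterion on `S`.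
[cite: BombieriLagarias1999, Thm. 1] -/
theorem riemannHypothesis_iff_liPosOn_of_bohrShift {H : ℝ} (hA : RiemannHypothesisUpTo H) (hHpos : 0 < H)
    {S : Set ℕ} {c : ℤ} (hS : (∀ (k : ℕ) (z : Fin k → ℂ), (∀ i, ‖z i‖ = 1) → ∀ ε : ℝ, 0 < ε →
      ∀ N : ℕ, ∃ n ∈ S, N ≤ n ∧ ∀ i, ‖z i ^ ((n : ℤ) - c) - 1‖ < ε)) (hc : 5 * |(c : ℝ)| ≤ H) :
    _root_.RiemannHypothesis ↔ LiPosOn S :=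
  riemannHypothesis_iff_liPosOn_of_rhUpTo_of_isSlowRecurrent hA hHpos
    (isSlowRecurrent_of_bohrShift hS (by
      rw [show |(c : ℝ)| * (2 / H) = (2 * |(c : ℝ)|) / H by ring,
        div_le_div_iff₀ hHpos (by norm_num : (0 : ℝ) < 5)]
      linarith))

/-- `H = 101` (tree, standard axioms): shifts `|c| ≤ 20`. [cite: BombieriLagarias1999, Thm. 1] -/
theorem riemannHypothesis_iff_liPosOn_of_bohrShift_le_20 {S : Set ℕ} {c : ℤ}
    (hS : (∀ (k : ℕ) (z : Fin k → ℂ), (∀ i, ‖z i‖ = 1) → ∀ ε : ℝ, 0 < ε →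
      ∀ N : ℕ, ∃ n ∈ S, N ≤ n ∧ ∀ i, ‖z i ^ ((n : ℤ) - c) - 1‖ < ε)) (hc : |c| ≤
          20) : _root_.RiemannHypothesis ↔ LiPosOn S :=
  riemannHypothesis_iff_liPosOn_of_bohrShift riemannHypothesisUpTo_hundredOne (by norm_num) hS
    (by
      have : |(c : ℝ)| ≤ 20 := by rw [← Int.cast_abs]; exact_mod_cast hc
      linarith)

/-- `H = 1000` (tree `riemannHypothesisUpTo_1000`, file `RiemannHypothesisUpTo1000X`, kernel `decide`,
standard axioms, no named fact): **every set slow-recurrent at scale `2/1000 = 1/500` carries an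
RH-equivalent Li criterion.** [cite: BombieriLagarias1999, Thm. 1] -/
theorem riemannHypothesis_iff_liPosOn_of_isSlowRecurrent_1000 {S : Set ℕ}
    (hS : (∀ (k : ℕ) (z : Fin k → ℂ), (∀ i, ‖z i‖ = 1) → (∀ i, ‖z i - 1‖ ≤ (2 / 1000)) →
      ∀ N : ℕ, ∃ n ∈ S, N ≤ n ∧ ∀ i, (1 : ℝ) / 2 ≤ (z i ^ n).re)) : _root_.RiemannHypothesis ↔ LiPosOn S :=
  riemannHypothesis_iff_liPosOn_of_rhUpTo_of_isSlowRecurrent riemannHypothesisUpTo_1000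
    (by norm_num) hS

/-- `H = 1000` (tree, standard axioms): Bohr-recurrent shifts `|c| ≤ 200`. [cite: BombieriLagarias1999, Thm. 1] -/
theorem riemannHypothesis_iff_liPosOn_of_bohrShift_le_200 {S : Set ℕ} {c : ℤ}
    (hS : (∀ (k : ℕ) (z : Fin k → ℂ), (∀ i, ‖z i‖ = 1) → ∀ ε : ℝ, 0 < ε →
      ∀ N : ℕ, ∃ n ∈ S, N ≤ n ∧ ∀ i, ‖z i ^ ((n : ℤ) - c) - 1‖ < ε)) (hc : |c| ≤
          200) : _root_.RiemannHypothesis ↔ LiPosOn S :=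
  riemannHypothesis_iff_liPosOn_of_bohrShift riemannHypothesisUpTo_1000 (by norm_num) hS
    (by
      have : |(c : ℝ)| ≤ 200 := by rw [← Int.cast_abs]; exact_mod_cast hc
      linarith)

end Summit.RiemannHypothesis.RiemannHypothesis.Theorems.Splittings.LiSlowRecurrence

end
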